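import Summits.ResolutionOfSingularities.ResolutionOfSingularities.Theorems.HilbertSamuelEliminationSigmaMaxModificationsCorridor3WLadderStrataBirthsTopRebirth
import Summits.ResolutionOfSingularities.ResolutionOfSingularities.Theorems.HilbertSamuelEliminationSigmaMaxModificationsCorridor3WLadderStrataBirthsTopClose
import Summits.ResolutionOfSingularities.ResolutionOfSingularities.Theorems.HilbertSamuelEliminationSigmaMaxModificationsCorridor3WLadderDepthAcrossStep
import Summits.ResolutionOfSingularities.ResolutionOfSingularities.Theorems.HilbertSamuelEliminationSigmaMaxModificationsCorridor3NearStep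
import HarnessLib

/-!
# [OURS · L1 W4.2] (b-end)₃ ROW-J — THE CLOSER: «no late depth jumps» `StrataCycleEndNoDepthJumps p 3 Q (3 ≤ ē)` from the
# REBIRTH DICTIONARY, the no-recurrent-RULED-birth claim and the cycle-end centre dichotomy — the surface branch by GEOMETRY
# (cell res-hironaka, LADDER-RESOLUTION rung L; slot W4.2, crux chain w42 `SigmaMaxModificationsCorridor3`
# stmt-ResolutionOfSingularities-19249; `--supports stmt-ResolutionOfSingularities-19249 --as helper`; res-L1-w42-plan-1 RULINGS
# v3.13-1 (AG) / v3.13-4 (AR); hand res-D-brk-3 (gen 5); row typer res-type-040 (D13), dictionary typer res-type-067)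

Everything here is OURS bookkeeping over res-type-040's `…StrataBirthsMovingDefs` (p517068: `HasSandwichAt`, row (b-jump)
`StrataCycleEndNoDepthJumps`), res-type-067's `…StrataBirthsTopDictionaryGraded` (p515936: `RuledBirthDatumD`, `IsCPFrameAlong`,
`NoRuledBirth3`, `CycleEndCentreDichotomy3`) and `…StrataBirthsTopRebirth` (p518178: `RebirthDictionary3`), and this seat's binder-free
geometry `…DepthAcrossStep` (p519213)
(`Helpers.exists_sandwich_image_of_fibre_subset`: depth does not jump across a one-point fibre). NOT a statement of Hironaka's
manuscript [Hironaka2017] nor of [CossartJannsenSaito2020]; no `Literature.…` named fact; never a `Theses/…` import. AI-written;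
no expert review; AI review is weaker than expert review.

## The composition (plan-1 RULINGS v3.13-4 (AR), shape of res-D-pv-002's D9 close mutatis mutandis)

Row (b-jump) asks: from some stage on, at a blown-up CYCLE-END step `X_n ← X_{n+1}` of a moving never-isolated W-top chain, an
irreducible component `Z' ∋ x_{n+1}` of `X_{n+1}(ν)` DOMINATING a component `Z = closure f(Z')` of `X_n(ν)` inside the centre and of
depth `≥ 2` at `x_{n+1}` (`HasSandwichAt`) dominates a component of depth `≥ 2` at `x_n`. Take `n₁` from `NoRuledBirth3`. At a later
such step the CYCLE-END CENTRE DICHOTOMY splits: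
* CURVE centre (some canonical centre admits a centre-adapted CP frame at `x_n`): were `Z` of depth `≤ 1` at `x_n`, the step would carry
  res-type-067's REBIRTH EVENT «`∃ Z' ∈ componentsThrough, HasSandwichAt (c (n+1)) Z' ∧ closure f(Z') ∈ componentsIn X_n(ν) ∧
  ¬ HasSandwichAt (c n) (closure f(Z'))`», so the REBIRTH DICTIONARY hands that frame the ruled-birth datum `RuledBirthDatumD`, which
  `NoRuledBirth3` forbids from `n₁` on — contradiction;
* SURFACE centre (the near fibre `f⁻¹(x_n) ∩ X_{n+1}(ν)` is a subsingleton): then `Z' ∩ f⁻¹(x_n) ⊆ {x_{n+1}}` and DEPTH DOES NOT JUMP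
  ACROSS A ONE-POINT FIBRE (`Helpers.exists_sandwich_image_of_fibre_subset`, relative Matsumura 15.1 on the stalks, PROVED) — the
  conclusion holds outright, with no claim consumed.
The binder `StrataDepthDiscipline` of plan-1's proposed signature is NOT needed (row (b-jump) carries the centre clause itself) and is
dropped. `RebirthDictionary3` is consumed BY NAME (res-type-067, p518178).

## What is proved (namespace `…Theorems.SigmaMaxModificationsCorridor3.Moving`)

* `hasSandwichAt_image_of_fibre_subset` — marked-stage form of the geometry: along any `f : X_{n+1} → X_n` with `f x_{n+1} = x_n`,
  `x_{n+1}` closed, an irreducible closed `Z' ∋ x_{n+1}` with `Z' ∩ f⁻¹(x_n) ⊆ {x_{n+1}}` and a sandwich at `x_{n+1}` has image closure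
  with a sandwich at `x_n`.
* `hasSandwichAt_eventually_of_rebirthDictionary` — the ROBUST form (stage predicate `H`, dichotomy assumed at `H`-stages only, as in
  002's `not_isFibreBirthAt_eventually_of_dictionary`; `H := IsHypStage` gives the hypersurface cell of RULINGS v3.12-4 (X3)).
* `strataCycleEndNoDepthJumps_three_of_dictionary` — **ROW-J CLOSED** for EVERY scope `Q` (so in particular at `QNe Q`):
  `RebirthDictionary3 p → NoRuledBirth3 p → CycleEndCentreDichotomy3 p → StrataCycleEndNoDepthJumps p 3 Q (3 ≤ ē)`.

Honesty: the two OURS CLAIMS consumed (rebirth dictionary, no recurrent ruled births) and the dichotomy are HYPOTHESES, named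
second-layer constructions under `stub_WtopEvNonIsoM_nonpointed` / `stub_Wtop3M_nonpointed`; `CycleEndCentreDichotomy3` as typed also
speaks at NON-hypersurface W-top stages (RULINGS v3.13-1 (AF): risk r-47) — the robust form isolates that. k21 (CANDIDATE KILL on the
non-pointed core, RULINGS v3.12-5 / v3.13-4) does not touch this composition's validity, only the truth of its OURS hypotheses for the
label oracle. References: CJS LNM 2270 Rem. 6.29 (1), Thm. 3.14 [CossartJannsenSaito2020]; Matsumura Thm. 15.1 [Matsumura1987];
tree p517068, p515936, p518178, p516610 (template), p519213; HOME STATUS res-L1-w42-plan-1 09:02:58Z (AG), 09:13:08Z (AR),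
res-type-067 09:04:35Z (2), res-D-brk-3 PACE #1 09:31:26Z.
-/

noncomputable section

set_option linter.dupNamespace false

open CategoryTheory AlgebraicGeometry TopologicalSpace Topology Polynomial
open Summit.ResolutionOfSingularities.ResolutionOfSingularities.Theorems.CampaignW42
open Literature.AlgebraicGeometry.Resolution Literature.RingTheory.HilbertSamuel
open Summit.ResolutionOfSingularities.ResolutionOfSingularities.Theorems.SigmaMaxModificationsCorridor3

namespace Summit.ResolutionOfSingularities.ResolutionOfSingularities.Theorems.SigmaMaxModificationsCorridor3.Moving

universe u

/-! ## §1. The geometry at a marked step: depth does not jump across a one-point fibre -/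

/-- [OURS · L1 W4.2] **DEPTH DOES NOT JUMP ACROSS A ONE-POINT FIBRE, at a marked step.** For marked stages `s`, `s'` and any
`f : X_{n+1} → X_n` with `f x_{n+1} = x_n`, `x_{n+1}` closed: an irreducible closed `Z' ∋ x_{n+1}` meeting the fibre over `x_n` in
`x_{n+1}` only and having a sandwich at `x_{n+1}` has image closure with a sandwich at `x_n` (PROVED: relative Matsumura 15.1 on the
stalks, `Helpers.exists_sandwich_image_of_fibre_subset`). [folklore] -/
theorem hasSandwichAt_image_of_fibre_subset {s s' : MarkedStage.{u}} {f : s'.W ⟶ s.W} (hpt : f.base s'.pt = s.pt)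
    (hcl : IsClosed ({s'.pt} : Set s'.W)) {Z' : Set s'.W} (hirr : IsIrreducible Z') (hZcl : IsClosed Z')
    (hfib : Z' ∩ f.base ⁻¹' {s.pt} ⊆ {s'.pt}) (hsw : HasSandwichAt s' Z') : HasSandwichAt s (closure (f.base '' Z')) := by
  haveI := s.ln
  haveI := s'.ln
  obtain ⟨B', hB'irr, hB'cl, hxB', hB'Z', hB'x, hB'ne⟩ := hsw
  obtain ⟨B, hBirr, hBcl, hxB, hBZ, hBx, hBne⟩ :=
    Helpers.exists_sandwich_image_of_fibre_subset f hcl hirr hZcl hB'irr hB'cl hxB' hB'Z' hB'x hB'ne (by rwa [hpt])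
  rw [hpt] at hxB hBx
  exact ⟨B, hBirr, hBcl, hxB, hBZ, hBx, hBne⟩

/-! ## §2. The composition, ROBUST form (dichotomy at `H`-stages) -/

/-- [OURS · L1 W4.2] **NO LATE DEPTH JUMPS at W-top along chains inside a stage predicate `H`** — the ROW-J composition in its ROBUST
form: for ANY stage predicate `H`, if the cycle-end centre dichotomy holds at `H`-stages, then along every moving never-isolated W-top chain
living in `H`, from `NoRuledBirth3`'s stage on, a dominating component through the chain point (image a component of `X_n(ν)`) with a
sandwich at `x_{n+1}` has image of depth `≥ 2` at `x_n` — CURVE branch by the rebirth dictionary (inline, res-type-067's wording) and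
`NoRuledBirth3`, SURFACE branch by geometry (`hasSandwichAt_image_of_fibre_subset`). The centre clause of row (b-jump) is not even used.
NOT a statement of the manuscript. [folklore] -/
theorem hasSandwichAt_eventually_of_rebirthDictionary {p : ℕ}
    (hre : RebirthDictionary3.{u} p)
    (hrec : NoRuledBirth3.{u} p)
    (H : MarkedStage.{u} → Prop)
    (hdich : ∀ (R : ∀ S : Scheme.{u}, CentreSeq S → Prop), OracleFunctional R → OracleAdmissible R →
      ∀ (ν : ℕ → ℕ) (X : Scheme.{u}) [IsLocallyNoetherian X] (x : X), IsMaximalOrigin p 3 ν X x →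
      ∀ c : ℕ → MarkedStage.{u}, Reaches R 3 ν (MarkedStage.init X x) (c 0) →
        (∀ n, CanonicalNearStep R 3 ν (c n) (c (n + 1))) → (∀ n, 3 ≤ (c n).geomDirDim) → (∀ n, ¬ Iso 3 (c n)) →
        ∀ n, (c n).IsBlownUp R 3 ν → (c (n + 1)).P = none → H (c n) →
          (∃ (C : (c n).W.IdealSheafData) (P' : Option (Pending (blowup C))) (Rf : Type) (_ : CommRing Rf) (u : Fin 3 → Rf)
              (h : Rf[X]) (φ : ((c n).W.presheaf.stalk (c n).pt : Type u) →+* Rf[X] ⧸ Ideal.span {h}),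
              IsCanonicalStep R 3 ν (c n).L (c n).P C P' ∧ IsCPFrameAlong (c n) C Rf u h φ) ∨
          (∀ f : (c (n + 1)).W ⟶ (c n).W, StepProjection R 3 ν (c n) (c (n + 1)) f →
              (f.base ⁻¹' {(c n).pt} ∩ Scheme.hsStratum (c (n + 1)).W 3 ν).Subsingleton))
    {R : ∀ S : Scheme.{u}, CentreSeq S → Prop} (hRf : OracleFunctional R) (hRa : OracleAdmissible R)
    {ν : ℕ → ℕ} {X : Scheme.{u}} [IsLocallyNoetherian X] {x : X} (hX : IsMaximalOrigin p 3 ν X x)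
    {c : ℕ → MarkedStage.{u}} (h0 : Reaches R 3 ν (MarkedStage.init X x) (c 0))
    (hstep : ∀ n, CanonicalNearStep R 3 ν (c n) (c (n + 1))) (hG : ∀ n, 3 ≤ (c n).geomDirDim) (hnI : ∀ n, ¬ Iso 3 (c n))
    (hmov : ∀ n, ∃ m, n ≤ m ∧ (c m).IsBlownUp R 3 ν) (hH : ∀ n, H (c n)) :
    ∃ n₁, ∀ n, n₁ ≤ n → (c n).IsBlownUp R 3 ν → (c (n + 1)).P = none →
      ∀ f : (c (n + 1)).W ⟶ (c n).W, StepProjection R 3 ν (c n) (c (n + 1)) f →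
        ∀ Z' ∈ componentsThrough 3 ν (c (n + 1)),
          closure (f.base '' Z') ∈ componentsIn (Scheme.hsStratum (c n).W 3 ν) →
          HasSandwichAt (c (n + 1)) Z' → HasSandwichAt (c n) (closure (f.base '' Z')) := by
  obtain ⟨_, k, _, hinv⟩ := exists_cycleInv_chain' hRf hRa hX h0 hstep
  obtain ⟨n₁, hn₁⟩ := hrec R hRf hRa ν X x hX c h0 hstep hG hnI hmov
  refine ⟨n₁, fun n hn hbu hnone f hf Z' hZ' hdom hsw => ?_⟩
  rcases hdich R hRf hRa ν X x hX c h0 hstep hG hnI n hbu hnone (hH n) with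
    ⟨C, P', Rf, _, u, h, φ, hcs, hframe⟩ | hsurf
  · -- CURVE centre: a depth jump would hand the adapted frame the ruled-birth datum, forbidden from `n₁` on
    by_contra hnot
    have hē : (c n).geomDirDim = 3 := le_antisymm (Helpers.chain_geomDirDim_le hX h0 hstep n) (hG n)
    exact hn₁ n hn hbu hnone C P' hcs Rf _ u h φ hframe
      (hre R hRf hRa ν X x hX (c n) (c (n + 1)) (reaches_chain h0 hstep n) (hstep n) hē hbu hnone C P' hcs f hf
        ⟨Z', hZ', hsw, hdom, hnot⟩ Rf _ u h φ hframe)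
  · -- SURFACE centre: the near fibre over `x_n` is at most the point `x_{n+1}`; depth does not jump across a one-point fibre
    have hY'cl : IsClosed (Scheme.hsStratum (c (n + 1)).W 3 ν) := (hinv (n + 1)).isClosed_hsStratum
    refine hasSandwichAt_image_of_fibre_subset hf.base_pt (Reaches.isClosed_pt hX.isClosed (reaches_chain h0 hstep (n + 1)))
      (componentsIn.isIrreducible hZ'.1) (componentsIn.isClosed hY'cl hZ'.1) ?_ hsw
    rintro z ⟨hzZ', hzf⟩
    exact (hsurf f hf) ⟨hzf, componentsIn.subset hZ'.1 hzZ'⟩ ⟨hf.base_pt, hf.pt_mem_hsStratum⟩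

/-! ## §3. ROW-J CLOSED, by name -/

/-- [OURS · L1 W4.2] **ROW-J CLOSED — `StrataCycleEndNoDepthJumps p 3 Q (3 ≤ ē)` from the REBIRTH DICTIONARY `RebirthDictionary3 p`
(res-type-067, p518178), `NoRuledBirth3 p` and `CycleEndCentreDichotomy3 p`**, for EVERY scope `Q` (so at `QNe Q`
as plan-1's (AR) asks; the binder `StrataDepthDiscipline` of the proposed signature is not needed and dropped). CAVEAT (RULINGS v3.13-1
(AF)): `CycleEndCentreDichotomy3` as typed also speaks at NON-hypersurface W-top stages (risk r-47); the honest hypersurface cell is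
`hasSandwichAt_eventually_of_rebirthDictionary` with `H :=` the typer's `IsHypStage`. NOT a statement of the manuscript. [folklore] -/
theorem strataCycleEndNoDepthJumps_three_of_dictionary {p : ℕ}
    (hre : RebirthDictionary3.{u} p)
    (hrec : NoRuledBirth3.{u} p) (hdich : CycleEndCentreDichotomy3.{u} p)
    (Q : ℕ → (ℕ → ℕ) → ∀ X : Scheme.{u}, X → Prop) :
    StrataCycleEndNoDepthJumps p 3 Q (fun s => 3 ≤ s.geomDirDim) := by
  intro R hRf hRa ν X _ x hX _hQ c h0 hstep hG hnI hmov
  obtain ⟨n₁, hn₁⟩ := hasSandwichAt_eventually_of_rebirthDictionary hre hrec (fun _ => True)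
    (fun R hRf hRa ν X _ x hX c h0 hstep hG hnI n hbu hnone _ => hdich R hRf hRa ν X x hX c h0 hstep hG hnI n hbu hnone)
    hRf hRa hX h0 hstep hG hnI hmov (fun _ => trivial)
  exact ⟨n₁, fun n hn hbu hnone f hf Z' hZ' hdom _ hsw => hn₁ n hn hbu hnone f hf Z' hZ' hdom hsw⟩

/-- [OURS · L1 W4.2] **ROW-J at the `QNe Q` scopes** (the exact shape of plan-1's RULINGS v3.13-4 (AR), minus the unused
`StrataDepthDiscipline` binder). NOT a statement of the manuscript. [folklore] -/
theorem strataCycleEndNoDepthJumps_three_qNe_of_dictionary {p : ℕ}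
    (hre : RebirthDictionary3.{u} p)
    (hrec : NoRuledBirth3.{u} p) (hdich : CycleEndCentreDichotomy3.{u} p)
    (Q : ℕ → (ℕ → ℕ) → ∀ X : Scheme.{u}, X → Prop) :
    StrataCycleEndNoDepthJumps p 3 (QNe Q) (fun s => 3 ≤ s.geomDirDim) :=
  strataCycleEndNoDepthJumps_three_of_dictionary hre hrec hdich (QNe Q)

end Summit.ResolutionOfSingularities.ResolutionOfSingularities.Theorems.SigmaMaxModificationsCorridor3.Moving

end
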